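import Literature.NumberTheory.Automorphic.UnipotentColumnRange
import HarnessLib

/-!
# The mirabolic tower of `GL_n`: the groups `Q_d`, corners, low rows, and the decompositions of
their points

Topic `NumberTheory/Automorphic`; namespace `Literature.NumberTheory.Automorphic`. Algebra over a
commutative ring `R` for the induction underlying the Fourier–Whittaker expansion and the
Rankin–Selberg unfolding on `GL_n` (Cogdell (2004), §1.1: the mirabolic `P_n ⊃ N_n` and the recursion
through `P_{n-1}, P_{n-2}, …`; Jacquet–Shalika (1981), §4). With `0`-based indices and a "depth"
`d : ℕ`:

* `tailUnipotent n R d = Q_d = {g ∈ GL_n(R) | g_{ij} = δ_{ij} for all i ≥ d, j ≤ i}` — the rows from `d`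
  on are unitriangular rows. `Q_{n-1} = P_n` is the **mirabolic subgroup** (last row `e_n`),
  `Q_0 = N_n`, and `Q_{d'} ≤ Q_d` for `d' ≤ d`; in block form `Q_d = GL_d ⋉ U_{[d, n-1]}` with `GL_d`
  the upper-left corner (`cornerGL`) and `U_{[d,n-1]}` the unipotent radical of the parabolic of type
  `(d, 1, …, 1)` (`unipotentColRange`), while `Q_{d-1} = P_d ⋉ U_{[d,n-1]}` with `P_d = Q_{d-1} ⊓ GL_d`
  the mirabolic of the corner. Over `K` these are the groups of the unfolding.
* `cornerGL n R d = {g | g_{ij} = δ_{ij} unless i, j < d} ≅ GL_d(R)`; `cornerize d g` — the corner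
  `diag(g|_{d×d}, 1)` of `g ∈ Q_e`, `e ≤ d`, which is invertible (`Q_e` is block upper triangular), with
  `cornerize_mem_cornerGL`, `cornerize_inv_mul_mem_unipotentColRange` — **`g = (corner) · u` with
  `u ∈ U_{[d,n-1]}`** — and the uniqueness `cornerGL d ⊓ U_{[d,b]} = ⊥`; for `p ∈ Q_e ⊓ GL_{d+1}` the
  unipotent part lies in the column group `Y_d = U_{[d,d]}` (`cornerize_inv_mul_mem_colGroup`).
* Normalisation: `GL_d` normalises `U_{[d, b]}` (`conj_mem_unipotentColRange_of_mem_cornerGL`).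
* `ColIdx n d = {j : Fin n // j < d}` and `lowRow d g` — the row `d - 1` of `g` on the columns `< d`,
  the invariant of the right coset `Q_{d-1} g`, `g ∈ Q_d` (`lowRow_mul_of_mem_pred`,
  `lowRow_mul_of_mem_cornerGL`, `mem_tailUnipotent_pred_iff`: `g ∈ Q_d` lies in `Q_{d-1}` iff
  `lowRow d g = e_{d-1}`); the corner embedding `lowCornerGL d : GL_{ColIdx n d}(R) →* GL_n(R)` with its
  low row (`lowRow_lowCornerGL`) and naturality; and, over a field, `exists_gl_row_eq` — **every
  non-zero vector is a row of an invertible matrix** — so that every `η ≠ 0` is a low row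
  (`exists_lowRow_lowCornerGL_eq`), i.e. `Q_{d-1} \ Q_d ≅ K^d ∖ {0}`.

Everything here is elementary matrix algebra, proved; no measure theory.

## References

* J. W. Cogdell, *Analytic theory of L-functions for GL_n*, in *An Introduction to the Langlands
  Program* (2004), §1.1 [CogdellAnalyticTheory2004].
* H. Jacquet, J. A. Shalika, *On Euler products and the classification of automorphic
  representations I*, Amer. J. Math. 103 (1981), §4 [JacquetShalikaAJM1981].
-/

noncomputable section

open Matrix Set
open scoped MatrixGroups

namespace Literature.NumberTheory.Automorphic

section Ring

variable (n : ℕ) (R : Type*) [CommRing R]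

/-! ### The groups `Q_d` -/

/-- **The group `Q_d ≤ GL_n(R)`** (`d : ℕ`): matrices whose rows `i ≥ d` are unitriangular rows,
`g_{ij} = δ_{ij}` for `j ≤ i`. `Q_{n-1}` is the mirabolic subgroup `P_n` (last row `(0,…,0,1)`),
`Q_0 = N_n`; `Q_d = GL_d ⋉ U_{[d,n-1]}` (Cogdell (2004), §1.1). [folklore] -/
def tailUnipotent (d : ℕ) : Subgroup (GL (Fin n) R) where
  carrier := {g | ∀ i j : Fin n, d ≤ (i : ℕ) → j ≤ i →
    (g : Matrix (Fin n) (Fin n) R) i j = if i = j then 1 else 0}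
  one_mem' := fun i j _ _ => by rw [Units.val_one, Matrix.one_apply]
  mul_mem' := by
    intro g h hg hh i j hi hji
    rw [Units.val_mul, Matrix.mul_apply]
    have key : ∀ l, (g : Matrix (Fin n) (Fin n) R) i l * (h : Matrix (Fin n) (Fin n) R) l j =
        if i = l then (h : Matrix (Fin n) (Fin n) R) i j else 0 := by
      intro l
      by_cases hli : l ≤ i
      · rw [hg i l hi hli]
        by_cases hil : i = l
        · subst hil; simp
        · rw [if_neg hil, zero_mul, if_neg hil]
      · have hil : i < l := lt_of_not_ge hli
        have hil' := Fin.lt_def.1 hil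
        rw [hh l j (by omega) (hji.trans hil.le), if_neg (ne_of_gt (lt_of_le_of_lt hji hil)), mul_zero,
          if_neg (ne_of_lt hil)]
    simp only [key, Finset.sum_ite_eq, Finset.mem_univ, if_true]
    exact hh i j hi hji
  inv_mem' := by
    intro g hg
    -- downward induction on the row, from `g g⁻¹ = 1`
    suffices h : ∀ m : ℕ, ∀ i j : Fin n, n ≤ (i : ℕ) + 1 + m → d ≤ (i : ℕ) → j ≤ i →
        ((g⁻¹ : GL (Fin n) R) : Matrix (Fin n) (Fin n) R) i j = if i = j then 1 else 0 by
      intro i j hi hji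
      exact h n i j (by omega) hi hji
    intro m
    induction m with
    | zero =>
      intro i j hin hi hji
      have hgg : ((g : Matrix (Fin n) (Fin n) R) * ((g⁻¹ : GL (Fin n) R) : Matrix (Fin n) (Fin n) R)) i j =
          if i = j then 1 else 0 := by
        rw [← Units.val_mul, mul_inv_cancel, Units.val_one, Matrix.one_apply]
      rw [Matrix.mul_apply] at hgg
      have key : ∀ l, (g : Matrix (Fin n) (Fin n) R) i l * ((g⁻¹ : GL (Fin n) R) : Matrix (Fin n) (Fin n) R) l j =
          if i = l then ((g⁻¹ : GL (Fin n) R) : Matrix (Fin n) (Fin n) R) i j else 0 := by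
        intro l
        have hli : l ≤ i := Fin.le_iff_val_le_val.2 (by have := l.2; omega)
        rw [hg i l hi hli]
        by_cases hil : i = l
        · subst hil; simp
        · rw [if_neg hil, zero_mul, if_neg hil]
      simp only [key, Finset.sum_ite_eq, Finset.mem_univ, if_true] at hgg
      exact hgg
    | succ m ih =>
      intro i j hin hi hji
      have hgg : ((g : Matrix (Fin n) (Fin n) R) * ((g⁻¹ : GL (Fin n) R) : Matrix (Fin n) (Fin n) R)) i j =
          if i = j then 1 else 0 := by
        rw [← Units.val_mul, mul_inv_cancel, Units.val_one, Matrix.one_apply]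
      rw [Matrix.mul_apply] at hgg
      have key : ∀ l, (g : Matrix (Fin n) (Fin n) R) i l * ((g⁻¹ : GL (Fin n) R) : Matrix (Fin n) (Fin n) R) l j =
          if i = l then ((g⁻¹ : GL (Fin n) R) : Matrix (Fin n) (Fin n) R) i j else 0 := by
        intro l
        by_cases hli : l ≤ i
        · rw [hg i l hi hli]
          by_cases hil : i = l
          · subst hil; simp
          · rw [if_neg hil, zero_mul, if_neg hil]
        · have hil : i < l := lt_of_not_ge hli
          have hil' := Fin.lt_def.1 hil
          have h1 : ((g⁻¹ : GL (Fin n) R) : Matrix (Fin n) (Fin n) R) l j = if l = j then 1 else 0 :=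
            ih l j (by omega) (by omega) (hji.trans hil.le)
          rw [h1, if_neg (ne_of_gt (lt_of_le_of_lt hji hil)), mul_zero, if_neg (ne_of_lt hil)]
      simp only [key, Finset.sum_ite_eq, Finset.mem_univ, if_true] at hgg
      exact hgg

variable {n R}

/-- Membership in `Q_d`. [folklore] -/
theorem mem_tailUnipotent_iff {d : ℕ} {g : GL (Fin n) R} :
    g ∈ tailUnipotent n R d ↔ ∀ i j : Fin n, d ≤ (i : ℕ) → j ≤ i →
      (g : Matrix (Fin n) (Fin n) R) i j = if i = j then 1 else 0 :=
  Iff.rfl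

/-- **Monotonicity**: `Q_{d'} ≤ Q_d` for `d' ≤ d` (more rows are constrained). [folklore] -/
theorem tailUnipotent_mono {d d' : ℕ} (h : d' ≤ d) : tailUnipotent n R d' ≤ tailUnipotent n R d :=
  fun _ hg i j hi hji => hg i j (h.trans hi) hji

/-- **`Q_0 = N_n`** (all rows are constrained). [folklore] -/
theorem tailUnipotent_zero : tailUnipotent n R 0 = upperUnitriangular (Fin n) R := by
  ext g
  rw [mem_tailUnipotent_iff, mem_upperUnitriangular_iff]
  constructor
  · intro h
    refine ⟨fun i j hij => ?_, fun i => ?_⟩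
    · rw [h i j (Nat.zero_le _) hij.le, if_neg (show i ≠ j from ne_of_gt hij)]
    · rw [h i i (Nat.zero_le _) le_rfl, if_pos rfl]
  · rintro ⟨ht, hd⟩ i j _ hji
    rcases eq_or_lt_of_le hji with rfl | hlt
    · rw [hd, if_pos rfl]
    · rw [ht hlt, if_neg (show i ≠ j from ne_of_gt hlt)]

/-- `N_n ≤ Q_d` for every `d`. [folklore] -/
theorem upperUnitriangular_le_tailUnipotent (d : ℕ) :
    upperUnitriangular (Fin n) R ≤ tailUnipotent n R d := by
  rw [← tailUnipotent_zero (n := n) (R := R)]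
  exact tailUnipotent_mono (Nat.zero_le _)

/-- In particular `U_{[a,b]} ≤ Q_d`. [folklore] -/
theorem unipotentColRange_le_tailUnipotent (a b d : ℕ) :
    unipotentColRange n R a b ≤ tailUnipotent n R d :=
  unipotentColRange_le_upperUnitriangular.trans (upperUnitriangular_le_tailUnipotent d)

/-- **`Q_{n-1}` is the mirabolic subgroup**: for `d + 1 = n`, `g ∈ Q_d` iff the last row of `g` is
`(0, …, 0, 1)`. [folklore] -/
theorem mem_tailUnipotent_iff_lastRow {d : ℕ} (hd : d + 1 = n) {g : GL (Fin n) R} :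
    g ∈ tailUnipotent n R d ↔ ∀ i j : Fin n, (i : ℕ) = d →
      (g : Matrix (Fin n) (Fin n) R) i j = if i = j then 1 else 0 := by
  rw [mem_tailUnipotent_iff]
  constructor
  · intro h i j hi
    exact h i j (by omega) (Fin.le_iff_val_le_val.2 (by have := j.2; omega))
  · intro h i j hi _
    exact h i j (by have := i.2; omega)

/-! ### Corners -/

variable (n R)

/-- **The upper-left corner `GL_d ≤ GL_n`**: matrices `g` with `g_{ij} = δ_{ij}` unless both
`i < d` and `j < d` (the image of `g₀ ↦ diag(g₀, 1)`, Cogdell's embedding `h ↦ (h 0; 0 1)`).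
[folklore] -/
def cornerGL (d : ℕ) : Subgroup (GL (Fin n) R) where
  carrier := {g | ∀ i j : Fin n, (d ≤ (i : ℕ) ∨ d ≤ (j : ℕ)) →
    (g : Matrix (Fin n) (Fin n) R) i j = if i = j then 1 else 0}
  one_mem' := fun i j _ => by rw [Units.val_one, Matrix.one_apply]
  mul_mem' := by
    intro g h hg hh i j hij
    rw [Units.val_mul, Matrix.mul_apply]
    rcases hij with hi | hj
    · have key : ∀ l, (g : Matrix (Fin n) (Fin n) R) i l * (h : Matrix (Fin n) (Fin n) R) l j =
          if i = l then (h : Matrix (Fin n) (Fin n) R) i j else 0 := by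
        intro l
        rw [hg i l (Or.inl hi)]
        by_cases hil : i = l
        · subst hil; simp
        · rw [if_neg hil, zero_mul, if_neg hil]
      simp only [key, Finset.sum_ite_eq, Finset.mem_univ, if_true]
      exact hh i j (Or.inl hi)
    · have key : ∀ l, (g : Matrix (Fin n) (Fin n) R) i l * (h : Matrix (Fin n) (Fin n) R) l j =
          if l = j then (g : Matrix (Fin n) (Fin n) R) i j else 0 := by
        intro l
        rw [hh l j (Or.inr hj)]
        by_cases hlj : l = j
        · subst hlj; simp
        · rw [if_neg hlj, mul_zero, if_neg hlj]
      simp only [key, Finset.sum_ite_eq', Finset.mem_univ, if_true]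
      exact hg i j (Or.inr hj)
  inv_mem' := by
    intro g hg i j hij
    rcases hij with hi | hj
    · have hgg : ((g : Matrix (Fin n) (Fin n) R) * ((g⁻¹ : GL (Fin n) R) : Matrix (Fin n) (Fin n) R)) i j =
          if i = j then 1 else 0 := by
        rw [← Units.val_mul, mul_inv_cancel, Units.val_one, Matrix.one_apply]
      rw [Matrix.mul_apply] at hgg
      have key : ∀ l, (g : Matrix (Fin n) (Fin n) R) i l * ((g⁻¹ : GL (Fin n) R) : Matrix (Fin n) (Fin n) R) l j =
          if i = l then ((g⁻¹ : GL (Fin n) R) : Matrix (Fin n) (Fin n) R) i j else 0 := by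
        intro l
        rw [hg i l (Or.inl hi)]
        by_cases hil : i = l
        · subst hil; simp
        · rw [if_neg hil, zero_mul, if_neg hil]
      simp only [key, Finset.sum_ite_eq, Finset.mem_univ, if_true] at hgg
      exact hgg
    · have hgg : (((g⁻¹ : GL (Fin n) R) : Matrix (Fin n) (Fin n) R) * (g : Matrix (Fin n) (Fin n) R)) i j =
          if i = j then 1 else 0 := by
        rw [← Units.val_mul, inv_mul_cancel, Units.val_one, Matrix.one_apply]
      rw [Matrix.mul_apply] at hgg
      have key : ∀ l, ((g⁻¹ : GL (Fin n) R) : Matrix (Fin n) (Fin n) R) i l * (g : Matrix (Fin n) (Fin n) R) l j =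
          if l = j then ((g⁻¹ : GL (Fin n) R) : Matrix (Fin n) (Fin n) R) i j else 0 := by
        intro l
        rw [hg l j (Or.inr hj)]
        by_cases hlj : l = j
        · subst hlj; simp
        · rw [if_neg hlj, mul_zero, if_neg hlj]
      simp only [key, Finset.sum_ite_eq', Finset.mem_univ, if_true] at hgg
      exact hgg

variable {n R}

/-- Membership in the corner. [folklore] -/
theorem mem_cornerGL_iff {d : ℕ} {g : GL (Fin n) R} :
    g ∈ cornerGL n R d ↔ ∀ i j : Fin n, (d ≤ (i : ℕ) ∨ d ≤ (j : ℕ)) →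
      (g : Matrix (Fin n) (Fin n) R) i j = if i = j then 1 else 0 :=
  Iff.rfl

/-- Corners are increasing in `d`. [folklore] -/
theorem cornerGL_mono {d d' : ℕ} (h : d ≤ d') : cornerGL n R d ≤ cornerGL n R d' :=
  fun _ hg i j hij => hg i j (hij.imp h.trans h.trans)

/-- **A corner element lies in `Q_d`**: the rows `≥ d` of `g ∈ GL_d` are unit rows. [folklore] -/
theorem cornerGL_le_tailUnipotent (d : ℕ) : cornerGL n R d ≤ tailUnipotent n R d :=
  fun _ hg i j hi _ => hg i j (Or.inl hi)

/-- **`GL_d ∩ U_{[d,b]} = 1`**: a corner element which is also unipotent with non-trivial columns only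
from `d` on is trivial. [folklore] -/
theorem cornerGL_inf_unipotentColRange_eq_bot (d b : ℕ) :
    cornerGL n R d ⊓ unipotentColRange n R d b = ⊥ := by
  refine (Subgroup.eq_bot_iff_forall _).2 fun g hg => ?_
  obtain ⟨hc, hu⟩ := Subgroup.mem_inf.1 hg
  refine Units.ext (Matrix.ext fun i j => ?_)
  rw [Units.val_one, Matrix.one_apply]
  by_cases hj : d ≤ (j : ℕ)
  · exact hc i j (Or.inr hj)
  · exact apply_of_not_inColRange hu i fun h => hj h.1

/-- **Corners normalise the column-range groups starting at the corner size**: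
`g u g⁻¹ ∈ U_{[d,b]}` for `g ∈ GL_d`, `u ∈ U_{[d,b]}`. Proof: the rows `≥ d` of `g` and the columns
`≥ d` of `g⁻¹` are unit vectors, so the entries of `g u g⁻¹` are: `δ_{ij}` in the columns `j < d`,
`u_{ij}` in the rows `i ≥ d` and columns `j ≥ d`, and `0` in the rows `< d` of an out-of-range column.
[folklore] -/
theorem conj_mem_unipotentColRange_of_mem_cornerGL {d b : ℕ} {g u : GL (Fin n) R}
    (hg : g ∈ cornerGL n R d) (hu : u ∈ unipotentColRange n R d b) :
    g * u * g⁻¹ ∈ unipotentColRange n R d b := by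
  have hginv : g⁻¹ ∈ cornerGL n R d := (cornerGL n R d).inv_mem hg
  obtain ⟨hut, hud⟩ := (mem_upperUnitriangular_iff u).1 hu.1
  -- (1) columns `j < d` are trivial
  have hcol_lt : ∀ i j : Fin n, ¬ d ≤ (j : ℕ) →
      ((g * u * g⁻¹ : GL (Fin n) R) : Matrix (Fin n) (Fin n) R) i j = if i = j then 1 else 0 := by
    intro i j hj
    have h1 : ∀ m, ((g * u : GL (Fin n) R) : Matrix (Fin n) (Fin n) R) i m *
        ((g⁻¹ : GL (Fin n) R) : Matrix (Fin n) (Fin n) R) m j =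
        (g : Matrix (Fin n) (Fin n) R) i m * ((g⁻¹ : GL (Fin n) R) : Matrix (Fin n) (Fin n) R) m j := by
      intro m
      by_cases hm : d ≤ (m : ℕ)
      · have hmj : m ≠ j := fun h => hj (h ▸ hm)
        rw [hginv m j (Or.inl hm), if_neg hmj, mul_zero, mul_zero]
      · have hum : ∀ l, (u : Matrix (Fin n) (Fin n) R) l m = if l = m then 1 else 0 :=
          fun l => apply_of_not_inColRange hu l fun h => hm h.1
        congr 1
        rw [Units.val_mul, Matrix.mul_apply]
        simp only [hum, mul_ite, mul_one, mul_zero, Finset.sum_ite_eq', Finset.mem_univ, if_true]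
    rw [Units.val_mul, Matrix.mul_apply]
    simp only [h1]
    rw [← Matrix.mul_apply, ← Units.val_mul, mul_inv_cancel, Units.val_one, Matrix.one_apply]
  -- (2) rows `i ≥ d`, columns `j ≥ d`: the entry is `u_{ij}`
  have hrow_ge : ∀ i j : Fin n, d ≤ (i : ℕ) → d ≤ (j : ℕ) →
      ((g * u * g⁻¹ : GL (Fin n) R) : Matrix (Fin n) (Fin n) R) i j = (u : Matrix (Fin n) (Fin n) R) i j := by
    intro i j hi hj
    rw [Units.val_mul, Matrix.mul_apply]
    have h2 : ∀ m, ((g * u : GL (Fin n) R) : Matrix (Fin n) (Fin n) R) i m *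
        ((g⁻¹ : GL (Fin n) R) : Matrix (Fin n) (Fin n) R) m j =
        if m = j then (u : Matrix (Fin n) (Fin n) R) i j else 0 := by
      intro m
      rw [hginv m j (Or.inr hj)]
      by_cases hmj : m = j
      · subst hmj
        simp only [if_true, mul_one]
        rw [Units.val_mul, Matrix.mul_apply]
        have h3 : ∀ l, (g : Matrix (Fin n) (Fin n) R) i l * (u : Matrix (Fin n) (Fin n) R) l m =
            if i = l then (u : Matrix (Fin n) (Fin n) R) i m else 0 := by
          intro l
          rw [hg i l (Or.inl hi)]
          by_cases hil : i = l
          · subst hil; simp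
          · rw [if_neg hil, zero_mul, if_neg hil]
        simp only [h3, Finset.sum_ite_eq, Finset.mem_univ, if_true]
      · rw [if_neg hmj, mul_zero, if_neg hmj]
    simp only [h2, Finset.sum_ite_eq', Finset.mem_univ, if_true]
  -- (3) rows `i < d`, columns `j ≥ d` out of range (`j > b`): the entry is `0`
  have hrow_lt : ∀ i j : Fin n, ¬ d ≤ (i : ℕ) → d ≤ (j : ℕ) → ¬ InColRange n d b j →
      ((g * u * g⁻¹ : GL (Fin n) R) : Matrix (Fin n) (Fin n) R) i j = 0 := by
    intro i j hi hj hjr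
    rw [Units.val_mul, Matrix.mul_apply]
    have h2 : ∀ m, ((g * u : GL (Fin n) R) : Matrix (Fin n) (Fin n) R) i m *
        ((g⁻¹ : GL (Fin n) R) : Matrix (Fin n) (Fin n) R) m j =
        if m = j then ((g * u : GL (Fin n) R) : Matrix (Fin n) (Fin n) R) i j else 0 := by
      intro m
      rw [hginv m j (Or.inr hj)]
      by_cases hmj : m = j
      · subst hmj; simp
      · rw [if_neg hmj, mul_zero, if_neg hmj]
    simp only [h2, Finset.sum_ite_eq', Finset.mem_univ, if_true]
    rw [Units.val_mul, Matrix.mul_apply]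
    have huj : ∀ l, (u : Matrix (Fin n) (Fin n) R) l j = if l = j then 1 else 0 :=
      fun l => apply_of_not_inColRange hu l hjr
    simp only [huj, mul_ite, mul_one, mul_zero, Finset.sum_ite_eq', Finset.mem_univ, if_true]
    have hij : i ≠ j := fun h => hi (h ▸ hj)
    rw [hg i j (Or.inr hj), if_neg hij]
  refine mem_unipotentColRange_of ?_ fun i j hij hjr => ?_
  · rw [mem_upperUnitriangular_iff]
    refine ⟨fun i j hji => ?_, fun i => ?_⟩
    · change ((g * u * g⁻¹ : GL (Fin n) R) : Matrix (Fin n) (Fin n) R) i j = 0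
      by_cases hj : d ≤ (j : ℕ)
      · have hi : d ≤ (i : ℕ) := hj.trans (Fin.lt_def.1 hji).le
        rw [hrow_ge i j hi hj, hut hji]
      · rw [hcol_lt i j hj, if_neg (show i ≠ j from ne_of_gt hji)]
    · change ((g * u * g⁻¹ : GL (Fin n) R) : Matrix (Fin n) (Fin n) R) i i = 1
      by_cases hi : d ≤ (i : ℕ)
      · rw [hrow_ge i i hi hi, hud i]
      · rw [hcol_lt i i hi, if_pos rfl]
  · by_cases hj : d ≤ (j : ℕ)
    · by_cases hi : d ≤ (i : ℕ)
      · rw [hrow_ge i j hi hj, hu.2 i j (ne_of_lt hij) hjr]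
      · exact hrow_lt i j hi hj hjr
    · rw [hcol_lt i j hj, if_neg (ne_of_lt hij)]

/-! ### The corner of an element of `Q_e` -/

/-- The entries of the upper-left `d × d` corner of `g`, extended by the identity. [folklore] -/
def cornerMatrix (d : ℕ) (g : GL (Fin n) R) : Matrix (Fin n) (Fin n) R :=
  Matrix.of fun i j => if (i : ℕ) < d ∧ (j : ℕ) < d then (g : Matrix (Fin n) (Fin n) R) i j
    else if i = j then 1 else 0

/-- Entries of `cornerMatrix`. [folklore] -/
theorem cornerMatrix_apply (d : ℕ) (g : GL (Fin n) R) (i j : Fin n) :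
    cornerMatrix d g i j = if (i : ℕ) < d ∧ (j : ℕ) < d then (g : Matrix (Fin n) (Fin n) R) i j
      else if i = j then 1 else 0 := rfl

/-- **The corner of `g ∈ Q_e` is invertible with inverse the corner of `g⁻¹`** (`e ≤ d`): `Q_e` is block
upper triangular for the blocks `{< d}`, `{≥ d}` with unitriangular lower-right block. [folklore] -/
theorem cornerMatrix_mul_cornerMatrix_inv {e d : ℕ} (hed : e ≤ d) {g : GL (Fin n) R}
    (hg : g ∈ tailUnipotent n R e) :
    cornerMatrix d g * cornerMatrix d g⁻¹ = 1 := by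
  have hginv : g⁻¹ ∈ tailUnipotent n R e := (tailUnipotent n R e).inv_mem hg
  ext i j
  rw [Matrix.mul_apply, Matrix.one_apply]
  by_cases hi : (i : ℕ) < d
  · by_cases hj : (j : ℕ) < d
    · have hgg : ((g : Matrix (Fin n) (Fin n) R) * ((g⁻¹ : GL (Fin n) R) : Matrix (Fin n) (Fin n) R)) i j =
          if i = j then 1 else 0 := by
        rw [← Units.val_mul, mul_inv_cancel, Units.val_one, Matrix.one_apply]
      rw [Matrix.mul_apply] at hgg
      rw [← hgg]
      refine Finset.sum_congr rfl fun l _ => ?_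
      simp only [cornerMatrix_apply, hi, hj, true_and, and_true]
      by_cases hl : (l : ℕ) < d
      · rw [if_pos hl, if_pos hl]
      · rw [if_neg hl, if_neg hl]
        have hld : d ≤ (l : ℕ) := not_lt.1 hl
        have hjl : j ≤ l := Fin.le_iff_val_le_val.2 (by omega)
        have hlj : l ≠ j := fun h => by subst h; omega
        have hil : i ≠ l := fun h => by subst h; omega
        rw [hginv l j (hed.trans hld) hjl, if_neg hlj, mul_zero, mul_zero]
    · have hij : i ≠ j := fun h => by subst h; omega
      rw [if_neg hij]
      refine Finset.sum_eq_zero fun l _ => ?_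
      simp only [cornerMatrix_apply, hj, and_false, if_false]
      by_cases hlj : l = j
      · subst hlj
        simp only [if_true, mul_one, hi, hj, and_false, if_false, if_neg hij]
      · rw [if_neg hlj, mul_zero]
  · have hrow : ∀ l, cornerMatrix d g i l = if i = l then 1 else 0 := fun l => by
      rw [cornerMatrix_apply, if_neg (fun h => hi h.1)]
    simp only [hrow, ite_mul, one_mul, zero_mul, Finset.sum_ite_eq, Finset.mem_univ, if_true]
    rw [cornerMatrix_apply, if_neg (fun h => hi h.1)]

/-- The same on the other side. [folklore] -/
theorem cornerMatrix_inv_mul_cornerMatrix {e d : ℕ} (hed : e ≤ d) {g : GL (Fin n) R}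
    (hg : g ∈ tailUnipotent n R e) :
    cornerMatrix d g⁻¹ * cornerMatrix d g = 1 := by
  have h := cornerMatrix_mul_cornerMatrix_inv (d := d) hed ((tailUnipotent n R e).inv_mem hg)
  rwa [inv_inv] at h

/-- **The corner `cornerize d g ∈ GL_n(R)`** of `g ∈ Q_e`, `e ≤ d`: the invertible matrix
`diag(g|_{d × d}, 1)`. [folklore] -/
def cornerize {e : ℕ} (d : ℕ) (hed : e ≤ d) (g : GL (Fin n) R) (hg : g ∈ tailUnipotent n R e) :
    GL (Fin n) R where
  val := cornerMatrix d g
  inv := cornerMatrix d g⁻¹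
  val_inv := cornerMatrix_mul_cornerMatrix_inv hed hg
  inv_val := cornerMatrix_inv_mul_cornerMatrix hed hg

/-- The matrix of the corner (definitional). [folklore] -/
@[simp]
theorem coe_cornerize {e : ℕ} (d : ℕ) (hed : e ≤ d) (g : GL (Fin n) R) (hg : g ∈ tailUnipotent n R e) :
    ((cornerize d hed g hg : GL (Fin n) R) : Matrix (Fin n) (Fin n) R) = cornerMatrix d g := rfl

/-- The inverse matrix of the corner (definitional). [folklore] -/
@[simp]
theorem coe_cornerize_inv {e : ℕ} (d : ℕ) (hed : e ≤ d) (g : GL (Fin n) R) (hg : g ∈ tailUnipotent n R e) :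
    (((cornerize d hed g hg)⁻¹ : GL (Fin n) R) : Matrix (Fin n) (Fin n) R) = cornerMatrix d g⁻¹ := rfl

/-- The corner lies in `GL_d`. [folklore] -/
theorem cornerize_mem_cornerGL {e : ℕ} (d : ℕ) (hed : e ≤ d) (g : GL (Fin n) R)
    (hg : g ∈ tailUnipotent n R e) : cornerize d hed g hg ∈ cornerGL n R d := by
  intro i j hij
  rw [coe_cornerize, cornerMatrix_apply]
  have : ¬ ((i : ℕ) < d ∧ (j : ℕ) < d) := fun h => by rcases hij with h' | h' <;> omega
  rw [if_neg this]

/-- The corner of `g ∈ Q_e` lies in `Q_e`. [folklore] -/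
theorem cornerize_mem_tailUnipotent {e : ℕ} (d : ℕ) (hed : e ≤ d) (g : GL (Fin n) R)
    (hg : g ∈ tailUnipotent n R e) : cornerize d hed g hg ∈ tailUnipotent n R e := by
  intro i j hi hji
  rw [coe_cornerize, cornerMatrix_apply]
  by_cases h : (i : ℕ) < d ∧ (j : ℕ) < d
  · rw [if_pos h]; exact hg i j hi hji
  · rw [if_neg h]

/-- **The unipotent part**: `(cornerize d g)⁻¹ g ∈ U_{[d, b]}` for `g ∈ Q_e`, `e ≤ d`, `n ≤ b + 1`
(the columns `< d` of `(corner)⁻¹ g` are those of `(corner)⁻¹ (corner) = 1`, the rows `≥ d` are the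
unitriangular rows of `g`). [folklore] -/
theorem cornerize_inv_mul_mem_unipotentColRange {e : ℕ} (d : ℕ) (hed : e ≤ d) {b : ℕ}
    (hb : n ≤ b + 1) (g : GL (Fin n) R) (hg : g ∈ tailUnipotent n R e) :
    (cornerize d hed g hg)⁻¹ * g ∈ unipotentColRange n R d b := by
  have hent_lt : ∀ i j : Fin n, (j : ℕ) < d →
      (((cornerize d hed g hg)⁻¹ * g : GL (Fin n) R) : Matrix (Fin n) (Fin n) R) i j =
        if i = j then 1 else 0 := by
    intro i j hj
    rw [Units.val_mul, coe_cornerize_inv, Matrix.mul_apply]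
    by_cases hi : (i : ℕ) < d
    · have hgg : (((g⁻¹ : GL (Fin n) R) : Matrix (Fin n) (Fin n) R) * (g : Matrix (Fin n) (Fin n) R)) i j =
          if i = j then 1 else 0 := by
        rw [← Units.val_mul, inv_mul_cancel, Units.val_one, Matrix.one_apply]
      rw [Matrix.mul_apply] at hgg
      rw [← hgg]
      refine Finset.sum_congr rfl fun l _ => ?_
      rw [cornerMatrix_apply]
      by_cases hl : (l : ℕ) < d
      · rw [if_pos ⟨hi, hl⟩]
      · rw [if_neg (fun h => hl h.2)]
        have hjl : j ≤ l := Fin.le_iff_val_le_val.2 (by omega)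
        have hlj : l ≠ j := fun h => by subst h; omega
        have hil : i ≠ l := fun h => by subst h; omega
        rw [hg l j (hed.trans (by omega)) hjl, if_neg hlj, mul_zero, mul_zero]
    · have key : ∀ l, cornerMatrix d g⁻¹ i l * (g : Matrix (Fin n) (Fin n) R) l j =
          if i = l then (g : Matrix (Fin n) (Fin n) R) i j else 0 := by
        intro l
        rw [cornerMatrix_apply, if_neg (fun h => hi h.1)]
        by_cases hil : i = l
        · subst hil; simp
        · rw [if_neg hil, zero_mul, if_neg hil]
      simp only [key, Finset.sum_ite_eq, Finset.mem_univ, if_true]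
      exact hg i j (hed.trans (by omega)) (Fin.le_iff_val_le_val.2 (by omega))
  have hent_ge : ∀ i j : Fin n, d ≤ (i : ℕ) →
      (((cornerize d hed g hg)⁻¹ * g : GL (Fin n) R) : Matrix (Fin n) (Fin n) R) i j =
        (g : Matrix (Fin n) (Fin n) R) i j := by
    intro i j hi
    rw [Units.val_mul, coe_cornerize_inv, Matrix.mul_apply]
    have key : ∀ l, cornerMatrix d g⁻¹ i l * (g : Matrix (Fin n) (Fin n) R) l j =
        if i = l then (g : Matrix (Fin n) (Fin n) R) i j else 0 := by
      intro l
      rw [cornerMatrix_apply, if_neg (fun h => by omega)]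
      by_cases hil : i = l
      · subst hil; simp
      · rw [if_neg hil, zero_mul, if_neg hil]
    simp only [key, Finset.sum_ite_eq, Finset.mem_univ, if_true]
  refine ⟨(mem_upperUnitriangular_iff _).2 ⟨fun i j hji => ?_, fun i => ?_⟩, fun i j hij hj => ?_⟩
  · change (((cornerize d hed g hg)⁻¹ * g : GL (Fin n) R) : Matrix (Fin n) (Fin n) R) i j = 0
    by_cases hjd : (j : ℕ) < d
    · rw [hent_lt i j hjd, if_neg (show i ≠ j from ne_of_gt hji)]
    · have hi : d ≤ (i : ℕ) := (not_lt.1 hjd).trans (Fin.lt_def.1 hji).le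
      rw [hent_ge i j hi, hg i j (hed.trans hi) hji.le, if_neg (show i ≠ j from ne_of_gt hji)]
  · change (((cornerize d hed g hg)⁻¹ * g : GL (Fin n) R) : Matrix (Fin n) (Fin n) R) i i = 1
    by_cases hid : (i : ℕ) < d
    · rw [hent_lt i i hid, if_pos rfl]
    · rw [hent_ge i i (not_lt.1 hid), hg i i (hed.trans (not_lt.1 hid)) le_rfl, if_pos rfl]
  · by_cases hjd : (j : ℕ) < d
    · rw [hent_lt i j hjd, if_neg hij]
    · exfalso
      have := j.2
      exact hj ⟨not_lt.1 hjd, by omega⟩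

/-- **The decomposition `g = (corner) · (unipotent part)`** (by associativity). [folklore] -/
theorem cornerize_mul_decomposition {e : ℕ} (d : ℕ) (hed : e ≤ d) (g : GL (Fin n) R)
    (hg : g ∈ tailUnipotent n R e) :
    cornerize d hed g hg * ((cornerize d hed g hg)⁻¹ * g) = g := by
  rw [← mul_assoc, mul_inv_cancel, one_mul]

/-- **Uniqueness of the decomposition**: if `k u = k' u'` with `k, k' ∈ GL_d` and `u, u' ∈ U_{[d,b]}`
then `k = k'` and `u = u'` (`GL_d ∩ U_{[d,b]} = 1`). [folklore] -/
theorem corner_decomposition_unique {d b : ℕ} {k k' u u' : GL (Fin n) R} (hk : k ∈ cornerGL n R d)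
    (hk' : k' ∈ cornerGL n R d) (hu : u ∈ unipotentColRange n R d b)
    (hu' : u' ∈ unipotentColRange n R d b) (he : k * u = k' * u') : k = k' ∧ u = u' := by
  have h1 : k'⁻¹ * k = u' * u⁻¹ := by
    rw [inv_mul_eq_iff_eq_mul, ← mul_assoc, ← he, mul_assoc, mul_inv_cancel, mul_one]
  have hmem : k'⁻¹ * k ∈ cornerGL n R d ⊓ unipotentColRange n R d b := by
    refine Subgroup.mem_inf.2 ⟨(cornerGL n R d).mul_mem ((cornerGL n R d).inv_mem hk') hk, ?_⟩
    rw [h1]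
    exact (unipotentColRange n R d b).mul_mem hu' ((unipotentColRange n R d b).inv_mem hu)
  rw [cornerGL_inf_unipotentColRange_eq_bot, Subgroup.mem_bot, inv_mul_eq_one] at hmem
  subst hmem
  exact ⟨rfl, mul_left_cancel he⟩

/-- **The case of the next corner**: for `p ∈ Q_e ⊓ GL_{d+1}`, `e ≤ d`, the unipotent part
`(cornerize d p)⁻¹ p` lies in the column group `Y_d = U_{[d,d]}` (it lies in `U_{[d, n-1]}` and in
`GL_{d+1}`, whose elements have trivial columns `> d`). [folklore] -/
theorem cornerize_inv_mul_mem_colGroup {e d : ℕ} (hed : e ≤ d) {p : GL (Fin n) R}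
    (hp : p ∈ tailUnipotent n R e) (hpc : p ∈ cornerGL n R (d + 1)) :
    (cornerize d hed p hp)⁻¹ * p ∈ unipotentColRange n R d d := by
  have h1 := cornerize_inv_mul_mem_unipotentColRange d hed (b := n) (by omega) p hp
  have h2 : (cornerize d hed p hp)⁻¹ * p ∈ cornerGL n R (d + 1) :=
    (cornerGL n R (d + 1)).mul_mem ((cornerGL n R (d + 1)).inv_mem
      (cornerGL_mono (by omega) (cornerize_mem_cornerGL d hed p hp))) hpc
  refine ⟨h1.1, fun i j hij hj => ?_⟩
  by_cases hjd : d < (j : ℕ)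
  · rw [h2 i j (Or.inr (by omega)), if_neg hij]
  · exact h1.2 i j hij fun h => hj ⟨h.1, not_lt.1 hjd⟩

/-! ### The low row and the right cosets `Q_{d-1} \ Q_d` -/

/-- **The column indices below `d`**: `{j : Fin n // j < d}` — the index set of the entries of the
column group `Y_d ≅ 𝔾_a^d` and of the low rows at depth `d`. [folklore] -/
abbrev ColIdx (n d : ℕ) : Type := {j : Fin n // (j : ℕ) < d}

/-- **The low row of `g` at depth `d`**: the row `d - 1` of `g` restricted to the columns `< d`, for
`1 ≤ d ≤ n` (junk `0` if there is no such row). This is `e_{d-1} · (GL_d`-corner of `g)`, the invariant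
of the right coset `Q_{d-1} g` for `g ∈ Q_d` (Cogdell (2004), §1.1: the stabiliser of `e` is the
mirabolic). [folklore] -/
def lowRow (d : ℕ) (g : GL (Fin n) R) : ColIdx n d → R := fun j =>
  if h : 0 < d ∧ d - 1 < n then (g : Matrix (Fin n) (Fin n) R) ⟨d - 1, h.2⟩ j.1 else 0

/-- **`lowRow` is invariant under `Q_{d-1}` on the left**: `lowRow d (q g) = lowRow d g` for
`q ∈ Q_{d-1}` and `g ∈ Q_d` (the row `d-1` of `q` is a unitriangular row, and the rows `≥ d` of `g`
vanish in the columns `< d`). [folklore] -/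
theorem lowRow_mul_of_mem_pred {d : ℕ} {q g : GL (Fin n) R} (hq : q ∈ tailUnipotent n R (d - 1))
    (hg : g ∈ tailUnipotent n R d) : lowRow d (q * g) = lowRow d g := by
  funext j
  unfold lowRow
  split_ifs with h
  · set i : Fin n := ⟨d - 1, h.2⟩ with hi
    have hival : (i : ℕ) = d - 1 := rfl
    rw [Units.val_mul, Matrix.mul_apply]
    have key : ∀ l, (q : Matrix (Fin n) (Fin n) R) i l * (g : Matrix (Fin n) (Fin n) R) l j.1 =
        if i = l then (g : Matrix (Fin n) (Fin n) R) i j.1 else 0 := by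
      intro l
      by_cases hli : l ≤ i
      · rw [hq i l (by omega) hli]
        by_cases hil : i = l
        · subst hil; simp
        · rw [if_neg hil, zero_mul, if_neg hil]
      · have hil : i < l := lt_of_not_ge hli
        have hil' : (i : ℕ) < l := Fin.lt_def.1 hil
        have hj2 := j.2
        have hjl : j.1 ≤ l := Fin.le_iff_val_le_val.2 (by omega)
        have hlj : l ≠ j.1 := fun he => by rw [he] at hil'; omega
        rw [hg l j.1 (by omega) hjl, if_neg hlj, mul_zero, if_neg (ne_of_lt hil)]
    simp only [key, Finset.sum_ite_eq, Finset.mem_univ, if_true]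
  · rfl

/-- **`lowRow` under a corner on the right**: for `s ∈ GL_d` (corner),
`lowRow d (g s) j = Σ_{l} lowRow d g l · s_{lj}`. [folklore] -/
theorem lowRow_mul_of_mem_cornerGL {d : ℕ} (g : GL (Fin n) R) {s : GL (Fin n) R}
    (hs : s ∈ cornerGL n R d) (j : ColIdx n d) :
    lowRow d (g * s) j = ∑ l : ColIdx n d, lowRow d g l * (s : Matrix (Fin n) (Fin n) R) l.1 j.1 := by
  classical
  unfold lowRow
  split_ifs with h
  · set i : Fin n := ⟨d - 1, h.2⟩ with hi
    rw [Units.val_mul, Matrix.mul_apply]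
    have hzero : ∀ l : Fin n, ¬ ((l : ℕ) < d) →
        (g : Matrix (Fin n) (Fin n) R) i l * (s : Matrix (Fin n) (Fin n) R) l j.1 = 0 := by
      intro l hl
      have hlj : l ≠ j.1 := fun he => hl (by rw [he]; exact j.2)
      rw [hs l j.1 (Or.inl (not_lt.1 hl)), if_neg hlj, mul_zero]
    rw [← Finset.sum_subset (Finset.subset_univ (Finset.univ.filter fun l : Fin n => (l : ℕ) < d))
      (fun l _ hl => hzero l (by simpa using hl))]
    rw [Finset.sum_subtype (Finset.univ.filter fun l : Fin n => (l : ℕ) < d)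
      (p := fun l : Fin n => (l : ℕ) < d) (fun l => by simp)
      (fun l : Fin n => (g : Matrix (Fin n) (Fin n) R) i l * (s : Matrix (Fin n) (Fin n) R) l j.1)]
  · simp

/-- The standard low vector `e = e_{d-1}`. [folklore] -/
def lowStd (n d : ℕ) (R : Type*) [CommRing R] : ColIdx n d → R :=
  fun j => if (j.1 : ℕ) + 1 = d then 1 else 0

/-- **Membership in `Q_{d-1}` is read off the low row**: for `g ∈ Q_d`, `1 ≤ d ≤ n`, `g ∈ Q_{d-1}`
iff `lowRow d g = e_{d-1}`. [folklore] -/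
theorem mem_tailUnipotent_pred_iff {d : ℕ} (hd : 0 < d) (hdn : d - 1 < n) {g : GL (Fin n) R}
    (hg : g ∈ tailUnipotent n R d) :
    g ∈ tailUnipotent n R (d - 1) ↔ lowRow d g = lowStd n d R := by
  constructor
  · intro h
    funext j
    unfold lowRow lowStd
    rw [dif_pos ⟨hd, hdn⟩]
    have hj2 := j.2
    have hji : j.1 ≤ (⟨d - 1, hdn⟩ : Fin n) := Fin.le_iff_val_le_val.2 (by simp only; omega)
    rw [h ⟨d - 1, hdn⟩ j.1 (by simp only; omega) hji]
    by_cases he : (⟨d - 1, hdn⟩ : Fin n) = j.1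
    · rw [if_pos he, if_pos]
      have := congrArg Fin.val he
      simp only at this
      omega
    · rw [if_neg he, if_neg]
      intro h'
      exact he (Fin.ext (by simp only; omega))
  · intro h i j hi hji
    by_cases hid : d ≤ (i : ℕ)
    · exact hg i j hid hji
    · have hieq : (i : ℕ) = d - 1 := by omega
      have hji' := Fin.le_iff_val_le_val.1 hji
      have hjd : (j : ℕ) < d := by omega
      have hrow := congrFun h ⟨j, hjd⟩
      unfold lowRow lowStd at hrow
      rw [dif_pos ⟨hd, hdn⟩] at hrow
      have hi' : (⟨d - 1, hdn⟩ : Fin n) = i := Fin.ext (by simp [hieq])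
      rw [hi'] at hrow
      change (g : Matrix (Fin n) (Fin n) R) i j = (if (j : ℕ) + 1 = d then 1 else 0) at hrow
      rw [hrow]
      by_cases hij : i = j
      · subst hij; rw [if_pos (by omega), if_pos rfl]
      · rw [if_neg hij, if_neg]
        intro hj'
        exact hij (Fin.ext (by omega))

/-! ### Embedding a small invertible block as a corner -/

/-- The corner matrix `diag(B, 1)` of a square matrix `B` indexed by `ColIdx n d` (size `d`).
[folklore] -/
def lowCornerMatrix (d : ℕ) (B : Matrix (ColIdx n d) (ColIdx n d) R) : Matrix (Fin n) (Fin n) R :=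
  Matrix.of fun i j =>
    if hi : (i : ℕ) < d then (if hj : (j : ℕ) < d then B ⟨i, hi⟩ ⟨j, hj⟩ else 0)
    else (if i = j then 1 else 0)

/-- Entries of `lowCornerMatrix`. [folklore] -/
theorem lowCornerMatrix_apply (d : ℕ) (B : Matrix (ColIdx n d) (ColIdx n d) R) (i j : Fin n) :
    lowCornerMatrix d B i j =
      if hi : (i : ℕ) < d then (if hj : (j : ℕ) < d then B ⟨i, hi⟩ ⟨j, hj⟩ else 0)
      else (if i = j then 1 else 0) := rfl

/-- `diag(1, 1) = 1`. [folklore] -/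
theorem lowCornerMatrix_one (d : ℕ) :
    lowCornerMatrix (n := n) d (1 : Matrix (ColIdx n d) (ColIdx n d) R) = 1 := by
  ext i j
  rw [lowCornerMatrix_apply, Matrix.one_apply]
  by_cases hi : (i : ℕ) < d
  · rw [dif_pos hi]
    by_cases hj : (j : ℕ) < d
    · rw [dif_pos hj, Matrix.one_apply]
      by_cases hij : i = j
      · subst hij; simp
      · rw [if_neg (fun he => hij (congrArg Subtype.val he)), if_neg hij]
    · rw [dif_neg hj, if_neg]
      rintro rfl; exact hj hi
  · rw [dif_neg hi]

/-- `diag(B C, 1) = diag(B, 1) diag(C, 1)`. [folklore] -/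
theorem lowCornerMatrix_mul (d : ℕ) (B C : Matrix (ColIdx n d) (ColIdx n d) R) :
    lowCornerMatrix d (B * C) = lowCornerMatrix d B * lowCornerMatrix d C := by
  classical
  ext i j
  rw [Matrix.mul_apply, lowCornerMatrix_apply]
  by_cases hi : (i : ℕ) < d
  · rw [dif_pos hi]
    by_cases hj : (j : ℕ) < d
    · rw [dif_pos hj, Matrix.mul_apply]
      have hzero : ∀ l : Fin n, ¬ ((l : ℕ) < d) →
          lowCornerMatrix d B i l * lowCornerMatrix d C l j = 0 := by
        intro l hl
        rw [lowCornerMatrix_apply, dif_pos hi, dif_neg hl, zero_mul]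
      symm
      rw [← Finset.sum_subset (Finset.subset_univ (Finset.univ.filter fun l : Fin n => (l : ℕ) < d))
        (fun l _ hl => hzero l (by simpa using hl))]
      rw [Finset.sum_subtype (Finset.univ.filter fun l : Fin n => (l : ℕ) < d)
        (p := fun l : Fin n => (l : ℕ) < d) (fun l => by simp)
        (fun l : Fin n => lowCornerMatrix d B i l * lowCornerMatrix d C l j)]
      refine Finset.sum_congr rfl fun l _ => ?_
      rw [lowCornerMatrix_apply, lowCornerMatrix_apply, dif_pos hi, dif_pos l.2, dif_pos l.2, dif_pos hj]
    · rw [dif_neg hj]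
      symm
      refine Finset.sum_eq_zero fun l _ => ?_
      rw [lowCornerMatrix_apply, lowCornerMatrix_apply, dif_pos hi]
      by_cases hl : (l : ℕ) < d
      · rw [dif_pos hl, dif_pos hl, dif_neg hj, mul_zero]
      · rw [dif_neg hl, zero_mul]
  · rw [dif_neg hi]
    have key : ∀ l, lowCornerMatrix d B i l * lowCornerMatrix d C l j =
        if i = l then lowCornerMatrix d C i j else 0 := by
      intro l
      rw [lowCornerMatrix_apply, dif_neg hi]
      by_cases hil : i = l
      · subst hil; simp
      · rw [if_neg hil, zero_mul, if_neg hil]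
    simp only [key, Finset.sum_ite_eq, Finset.mem_univ, if_true]
    rw [lowCornerMatrix_apply, dif_neg hi]

/-- **The corner embedding `GL_d(R) →* GL_n(R)`**, `B ↦ diag(B, 1)`, with `GL_d` indexed by
`ColIdx n d`. [folklore] -/
def lowCornerGL (d : ℕ) : GL (ColIdx n d) R →* GL (Fin n) R where
  toFun B :=
    { val := lowCornerMatrix d (B : Matrix (ColIdx n d) (ColIdx n d) R)
      inv := lowCornerMatrix d ((B⁻¹ : GL (ColIdx n d) R) : Matrix (ColIdx n d) (ColIdx n d) R)
      val_inv := by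
        rw [← lowCornerMatrix_mul, ← Units.val_mul, mul_inv_cancel, Units.val_one, lowCornerMatrix_one]
      inv_val := by
        rw [← lowCornerMatrix_mul, ← Units.val_mul, inv_mul_cancel, Units.val_one, lowCornerMatrix_one] }
  map_one' := Units.ext (by
    change lowCornerMatrix d ((1 : GL (ColIdx n d) R) : Matrix (ColIdx n d) (ColIdx n d) R) = 1
    rw [Units.val_one, lowCornerMatrix_one])
  map_mul' B C := Units.ext (by
    change lowCornerMatrix d ((B * C : GL (ColIdx n d) R) : Matrix (ColIdx n d) (ColIdx n d) R) =
      lowCornerMatrix d (B : Matrix _ _ R) * lowCornerMatrix d (C : Matrix _ _ R)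
    rw [Units.val_mul, lowCornerMatrix_mul])

/-- The matrix of `lowCornerGL d B` (definitional). [folklore] -/
@[simp]
theorem coe_lowCornerGL (d : ℕ) (B : GL (ColIdx n d) R) :
    ((lowCornerGL (n := n) (R := R) d B : GL (Fin n) R) : Matrix (Fin n) (Fin n) R) =
      lowCornerMatrix d (B : Matrix (ColIdx n d) (ColIdx n d) R) := rfl

/-- `lowCornerGL d B` lies in the corner `GL_d`. [folklore] -/
theorem lowCornerGL_mem_cornerGL (d : ℕ) (B : GL (ColIdx n d) R) :
    lowCornerGL (n := n) (R := R) d B ∈ cornerGL n R d := by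
  intro i j hij
  rw [coe_lowCornerGL, lowCornerMatrix_apply]
  rcases hij with hi | hj
  · rw [dif_neg (by omega)]
  · by_cases hi : (i : ℕ) < d
    · rw [dif_pos hi, dif_neg (by omega), if_neg]
      rintro rfl; omega
    · rw [dif_neg hi]

/-- **The low row of a corner is the last row of the block**: `lowRow d (diag(B,1)) = B_{d-1, ·}`.
[folklore] -/
theorem lowRow_lowCornerGL {d : ℕ} (hd : 0 < d) (hdn : d - 1 < n) (B : GL (ColIdx n d) R) :
    lowRow d (lowCornerGL (n := n) (R := R) d B) =
      fun j => (B : Matrix (ColIdx n d) (ColIdx n d) R) ⟨⟨d - 1, hdn⟩, by simp only; omega⟩ j := by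
  funext j
  unfold lowRow
  rw [dif_pos ⟨hd, hdn⟩, coe_lowCornerGL, lowCornerMatrix_apply, dif_pos (by simp only; omega), dif_pos j.2]

/-- **Naturality** of the corner embedding in the ring. [folklore] -/
theorem map_lowCornerGL {S : Type*} [CommRing S] (f : R →+* S) (d : ℕ) (B : GL (ColIdx n d) R) :
    Matrix.GeneralLinearGroup.map f (lowCornerGL (n := n) (R := R) d B) =
      lowCornerGL (n := n) (R := S) d (Matrix.GeneralLinearGroup.map f B) := by
  refine Units.ext (Matrix.ext fun i j => ?_)
  change f (lowCornerMatrix d (B : Matrix (ColIdx n d) (ColIdx n d) R) i j) =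
    lowCornerMatrix d ((Matrix.GeneralLinearGroup.map f B : GL (ColIdx n d) S) : Matrix _ _ S) i j
  rw [lowCornerMatrix_apply, lowCornerMatrix_apply]
  by_cases hi : (i : ℕ) < d
  · rw [dif_pos hi, dif_pos hi]
    by_cases hj : (j : ℕ) < d
    · rw [dif_pos hj, dif_pos hj]; rfl
    · rw [dif_neg hj, dif_neg hj, map_zero]
  · rw [dif_neg hi, dif_neg hi]
    split_ifs
    · rw [map_one]
    · rw [map_zero]

/-! ### Over a field: every non-zero low vector is a low row -/

/-- **Every non-zero vector is a row of an invertible matrix**: for a field `F`, a finite index type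
with a distinguished index `i₀`, and `η ≠ 0` — say `η j₀ ≠ 0` — the matrix with rows `η` (at `i₀`),
`e_{i₀}` (at `j₀`, if `j₀ ≠ i₀`) and `e_i` elsewhere is invertible: its rows are linearly independent.
[folklore] -/
theorem exists_gl_row_eq {F : Type*} [Field F] {ι : Type*} [Fintype ι] [DecidableEq ι] (i₀ : ι)
    (η : ι → F) (hη : η ≠ 0) :
    ∃ B : GL ι F, (fun j => (B : Matrix ι ι F) i₀ j) = η := by
  classical
  obtain ⟨j₀, hj₀⟩ : ∃ j₀, η j₀ ≠ 0 := by
    by_contra h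
    push Not at h
    exact hη (funext h)
  let M : Matrix ι ι F := Matrix.of fun i j =>
    if i = i₀ then η j else if i = j₀ then (if j = i₀ then 1 else 0) else (if j = i then 1 else 0)
  have hMi : ∀ i j, M i j = if i = i₀ then η j else if i = j₀ then (if j = i₀ then 1 else 0)
      else (if j = i then 1 else 0) := fun i j => rfl
  have hrows : LinearIndependent F (fun i => M i) := by
    rw [Fintype.linearIndependent_iff]
    intro g hg i
    have hcol : ∀ j, ∑ i, g i * M i j = 0 := fun j => by
      have := congrFun hg j
      simpa [Finset.sum_apply, Pi.smul_apply, smul_eq_mul] using this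
    -- the coefficient of the `η`-row vanishes: look at the column `j₀`
    have h0 : g i₀ = 0 := by
      have := hcol j₀
      have e : ∑ i, g i * M i j₀ = g i₀ * η j₀ := by
        rw [Finset.sum_eq_single i₀]
        · rw [hMi, if_pos rfl]
        · intro i _ hi
          rw [hMi, if_neg hi]
          by_cases hi2 : i = j₀
          · rw [if_pos hi2]
            by_cases hji : j₀ = i₀
            · exact absurd (hi2.trans hji) hi
            · rw [if_neg hji, mul_zero]
          · rw [if_neg hi2, if_neg (Ne.symm hi2), mul_zero]
        · intro h; exact (h (Finset.mem_univ _)).elim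
      rw [e] at this
      exact (mul_eq_zero.1 this).resolve_right hj₀
    by_cases hi : i = i₀
    · rw [hi, h0]
    by_cases hij : i₀ = j₀
    · -- all other rows are `e_i`: look at the column `i`
      have := hcol i
      have e : ∑ i', g i' * M i' i = g i₀ * η i + g i := by
        rw [← Finset.add_sum_erase _ _ (Finset.mem_univ i₀), hMi, if_pos rfl]
        congr 1
        rw [Finset.sum_eq_single i]
        · rw [hMi, if_neg hi, if_neg (fun h => hi (h.trans hij.symm)), if_pos rfl, mul_one]
        · intro i' hi' hne
          rw [Finset.mem_erase] at hi'
          rw [hMi, if_neg hi'.1, if_neg (fun h => hi'.1 (h.trans hij.symm)), if_neg (Ne.symm hne), mul_zero]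
        · intro h
          exact (h (Finset.mem_erase.2 ⟨hi, Finset.mem_univ i⟩)).elim
      rw [e, h0, zero_mul, zero_add] at this
      exact this
    · -- the coefficient of the row `j₀` (which is `e_{i₀}`): column `i₀`
      have h1 : g j₀ = 0 := by
        have := hcol i₀
        have e : ∑ i, g i * M i i₀ = g i₀ * η i₀ + g j₀ := by
          rw [← Finset.add_sum_erase _ _ (Finset.mem_univ i₀), hMi, if_pos rfl]
          congr 1
          rw [Finset.sum_eq_single j₀]
          · rw [hMi, if_neg (Ne.symm hij), if_pos rfl, if_pos rfl, mul_one]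
          · intro i hi' hne
            rw [Finset.mem_erase] at hi'
            rw [hMi, if_neg hi'.1, if_neg hne, if_neg (Ne.symm hi'.1), mul_zero]
          · intro h
            exact (h (Finset.mem_erase.2 ⟨Ne.symm hij, Finset.mem_univ _⟩)).elim
        rw [e, h0, zero_mul, zero_add] at this
        exact this
      by_cases hi' : i = j₀
      · rw [hi', h1]
      · have := hcol i
        have e : ∑ i', g i' * M i' i = g i₀ * η i + g i := by
          rw [← Finset.add_sum_erase _ _ (Finset.mem_univ i₀), hMi, if_pos rfl]
          congr 1
          rw [Finset.sum_eq_single i]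
          · rw [hMi, if_neg hi, if_neg hi', if_pos rfl, mul_one]
          · intro i'' hi'' hne
            rw [Finset.mem_erase] at hi''
            rw [hMi, if_neg hi''.1]
            by_cases h2 : i'' = j₀
            · rw [if_pos h2, if_neg hi, mul_zero]
            · rw [if_neg h2, if_neg (Ne.symm hne), mul_zero]
          · intro h
            exact (h (Finset.mem_erase.2 ⟨hi, Finset.mem_univ i⟩)).elim
        rw [e, h0, zero_mul, zero_add] at this
        exact this
  have hdet : IsUnit M := Matrix.linearIndependent_rows_iff_isUnit.1 hrows
  refine ⟨hdet.unit, funext fun j => ?_⟩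
  rw [IsUnit.unit_spec, hMi, if_pos rfl]

/-- **Every non-zero `η : ColIdx n d → F` is a low row** of a corner element `diag(B, 1)`,
`B ∈ GL_d(F)` (`1 ≤ d ≤ n`). [folklore] -/
theorem exists_lowRow_lowCornerGL_eq {F : Type*} [Field F] {d : ℕ} (hd : 0 < d) (hdn : d - 1 < n)
    (η : ColIdx n d → F) (hη : η ≠ 0) :
    ∃ B : GL (ColIdx n d) F, lowRow d (lowCornerGL (n := n) (R := F) d B) = η := by
  classical
  obtain ⟨B, hB⟩ := exists_gl_row_eq (⟨⟨d - 1, hdn⟩, by simp only; omega⟩ : ColIdx n d) η hη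
  exact ⟨B, by rw [lowRow_lowCornerGL hd hdn]; exact hB⟩

/-! ### The decomposition `Q_e ⊓ GL_{c'} ≅ (Q_e ⊓ GL_c) × U_{[c, c'-1]}` as an equivalence -/

/-- `GL_{c'} = GL_n` for `c' ≥ n`: the corner condition is vacuous. [folklore] -/
theorem mem_cornerGL_of_le {c' : ℕ} (h : n ≤ c') (g : GL (Fin n) R) : g ∈ cornerGL n R c' := by
  intro i j hij
  exfalso
  rcases hij with hi | hj
  · exact absurd i.2 (not_lt.2 (h.trans hi))
  · exact absurd j.2 (not_lt.2 (h.trans hj))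

/-- **`U_{[a,b]} ≤ GL_{b+1}`** (the non-trivial columns are `≤ b`, the rows `> b` are unit rows).
[folklore] -/
theorem unipotentColRange_le_cornerGL (a b : ℕ) : unipotentColRange n R a b ≤ cornerGL n R (b + 1) := by
  intro u hu i j hij
  rcases hij with hi | hj
  · by_cases hji : j ≤ i
    · exact apply_of_le hu hji
    · exact apply_of_not_inColRange hu i fun h => by
        have := Fin.lt_def.1 (lt_of_not_ge hji); have h2 := h.2; omega
  · exact apply_of_not_inColRange hu i fun h => by have h2 := h.2; omega

/-- An element of `U_{[c,b]}` lying in the corner `GL_{c'}` lies in `U_{[c, c'-1]}` (its columns `≥ c'`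
are trivial). [folklore] -/
theorem mem_unipotentColRange_of_mem_cornerGL {c b c' : ℕ} (hc' : 0 < c') {u : GL (Fin n) R}
    (hu : u ∈ unipotentColRange n R c b) (huc : u ∈ cornerGL n R c') :
    u ∈ unipotentColRange n R c (c' - 1) := by
  refine ⟨hu.1, fun i j hij hj => ?_⟩
  by_cases hjc : c' ≤ (j : ℕ)
  · rw [huc i j (Or.inr hjc), if_neg hij]
  · exact hu.2 i j hij fun h => hj ⟨h.1, by omega⟩

/-- Membership in `Q_e ⊓ GL_{c'}` descends/ascends: `k u ∈ Q_e ⊓ GL_{c'}` for `k ∈ Q_e ⊓ GL_c`,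
`u ∈ U_{[c, c'-1]}`, `c ≤ c'`, `0 < c'`. [folklore] -/
theorem mul_mem_tailUnipotent_inf_cornerGL {e c c' : ℕ} (hcc' : c ≤ c') (hc' : 0 < c')
    {k u : GL (Fin n) R} (hk : k ∈ tailUnipotent n R e ⊓ cornerGL n R c)
    (hu : u ∈ unipotentColRange n R c (c' - 1)) :
    k * u ∈ tailUnipotent n R e ⊓ cornerGL n R c' := by
  obtain ⟨hkt, hkc⟩ := Subgroup.mem_inf.1 hk
  refine Subgroup.mem_inf.2 ⟨(tailUnipotent n R e).mul_mem hkt (unipotentColRange_le_tailUnipotent _ _ _ hu),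
    (cornerGL n R c').mul_mem (cornerGL_mono hcc' hkc) ?_⟩
  have h := unipotentColRange_le_cornerGL c (c' - 1) hu
  rwa [Nat.sub_add_cancel hc'] at h

/-- **The decomposition `Q_e ⊓ GL_{c'} ≅ (Q_e ⊓ GL_c) × U_{[c, c'-1]}`** (`e ≤ c ≤ c'`, `0 < c'`,
`n ≤ c'` allowed, in which case `GL_{c'} = GL_n`, `mem_cornerGL_of_le`): `p ↦ (corner_c(p), corner_c(p)⁻¹ p)` with inverse
the multiplication. Special cases: `Q_d ≅ P_{d+1} × U_{[d+1,n-1]}` (`e = d`, `c = d + 1`, `c' = n`),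
`P_{d+1} ≅ GL_d × Y_d` (`e = d = c`, `c' = d + 1`), `Q_d ≅ GL_d × U_{[d,n-1]}` (`e = d = c`, `c' = n`) —
the bijections behind the unfolding computations of the Rankin–Selberg method (Cogdell (2004), §2.3).
[folklore] -/
def tailCornerEquiv (e c c' : ℕ) (hec : e ≤ c) (hcc' : c ≤ c') (hc' : 0 < c') :
    ↥(tailUnipotent n R e ⊓ cornerGL n R c') ≃
      ↥(tailUnipotent n R e ⊓ cornerGL n R c) × ↥(unipotentColRange n R c (c' - 1)) where
  toFun p :=
    (⟨cornerize c hec (p : GL (Fin n) R) (Subgroup.mem_inf.1 p.2).1,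
      Subgroup.mem_inf.2 ⟨cornerize_mem_tailUnipotent c hec _ _, cornerize_mem_cornerGL c hec _ _⟩⟩,
     ⟨(cornerize c hec (p : GL (Fin n) R) (Subgroup.mem_inf.1 p.2).1)⁻¹ * p,
      mem_unipotentColRange_of_mem_cornerGL hc'
        (cornerize_inv_mul_mem_unipotentColRange c hec (b := c' + (n - 1) - 1) (by omega) _ _)
        ((cornerGL n R c').mul_mem ((cornerGL n R c').inv_mem
          (cornerGL_mono hcc' (cornerize_mem_cornerGL c hec _ _))) (Subgroup.mem_inf.1 p.2).2)⟩)
  invFun q := ⟨(q.1 : GL (Fin n) R) * q.2, mul_mem_tailUnipotent_inf_cornerGL hcc' hc' q.1.2 q.2.2⟩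
  left_inv p := Subtype.ext (cornerize_mul_decomposition c hec _ _)
  right_inv q := by
    obtain ⟨⟨k, hk⟩, ⟨u, hu⟩⟩ := q
    have hk' := Subgroup.mem_inf.1 hk
    -- uniqueness of the decomposition in `GL_c × U_{[c, c'+(n-1)-1]}`
    have hku : k * u ∈ tailUnipotent n R e := (Subgroup.mem_inf.1 (mul_mem_tailUnipotent_inf_cornerGL hcc' hc' hk hu)).1
    have h := corner_decomposition_unique (d := c) (b := c' + (n - 1) - 1)
      (cornerize_mem_cornerGL c hec (k * u) hku) hk'.2
      (cornerize_inv_mul_mem_unipotentColRange c hec (by omega) (k * u) hku)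
      (unipotentColRange_mono le_rfl (by omega) hu)
      (cornerize_mul_decomposition c hec (k * u) hku)
    refine Prod.ext (Subtype.ext h.1) (Subtype.ext ?_)
    change (cornerize c hec (k * u) hku)⁻¹ * (k * u) = u
    rw [h.1, ← mul_assoc, inv_mul_cancel, one_mul]

/-- The first component of `tailCornerEquiv` times the second is the element. [folklore] -/
theorem tailCornerEquiv_mul {e c c' : ℕ} (hec : e ≤ c) (hcc' : c ≤ c') (hc' : 0 < c')
    (p : ↥(tailUnipotent n R e ⊓ cornerGL n R c')) :
    ((tailCornerEquiv (n := n) (R := R) e c c' hec hcc' hc' p).1 : GL (Fin n) R) *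
      ((tailCornerEquiv (n := n) (R := R) e c c' hec hcc' hc' p).2 : GL (Fin n) R) = p :=
  cornerize_mul_decomposition c hec _ _

/-- The inverse of `tailCornerEquiv` is multiplication. [folklore] -/
theorem tailCornerEquiv_symm_apply {e c c' : ℕ} (hec : e ≤ c) (hcc' : c ≤ c') (hc' : 0 < c')
    (q : ↥(tailUnipotent n R e ⊓ cornerGL n R c) × ↥(unipotentColRange n R c (c' - 1))) :
    (((tailCornerEquiv (n := n) (R := R) e c c' hec hcc' hc').symm q : ↥(tailUnipotent n R e ⊓ cornerGL n R c')) :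
      GL (Fin n) R) = (q.1 : GL (Fin n) R) * q.2 := rfl

end Ring

end Literature.NumberTheory.Automorphic
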